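import Mathlib.Topology.ContinuousMap.Bounded.Basic
import Mathlib.Topology.Order.LeftRight
import Mathlib.Topology.Instances.Real.Lemmas
import HarnessLib

/-!
# Gluing a one-sided limit onto a face: a `(P →ᵇ E)`-valued map on `(a, b)` with a limit at `a⁺` extends to a JOINTLY continuous function on `[a, b) × P`
# (Dieudonné, *Foundations of Modern Analysis* (1960), (3.15.4), (7.2.1); Bourbaki, *Topologie générale* X §1)

Topic `Topology`; namespace `Literature.Topology`.  THEOREMS ONLY (no definition, no instance, no notation, no axiom, no named fact, no `sorry`); plain Mathlib topology.

THE POINT.  A family `u t ∈ (P →ᵇ E)` (`t` in an open interval `(a, b)`, `P` any topological space, `E` pseudo-metric) that is continuous in `t` and converges in the sup norm as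
`t → a⁺` to `L : P →ᵇ E` — i.e. `u t p → L p` UNIFORMLY in `p` — glues with `L` to a map continuous on `[a, b)` (`continuousOn_Ico_glue_of_tendsto`), and the evaluated function
`(t, p) ↦ (glued t) p` is JOINTLY continuous on `[a, b) × P` (`continuousOn_eval_Ico_glue_of_tendsto`; the subtype form on `[a, b′] × P`, `b′ < b`, for compact-parameter consumers:
`continuous_eval_Icc_glue_of_tendsto`); mirror statements at the right end `b⁻`.  Uniformity is carried by the sup-norm topology of `P →ᵇ E`, joint continuity by Mathlib's
`ContinuousEval (P →ᵇ E) P E`.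
WHY (cell `pub/hodgecm-mathlib`, crux H413 `stmt-HodgeConjecture-24833`, line LH3, letter L3′ (α4) stage (α4-S6) «multi-wall base points», census
`F0/P3c/LH10/LH10-p01/g4/s6/CENSUS-alpha4-S6.v1.md` brick (S6-B3)): in the induction invariant every mixed `ψ`-partial of the k-fold normalised orbital object must extend JOINTLY
continuously to the faces `ψ_i = 0±` of its sign orthant; ★ p850822 `RankOneCasimir.exists_tendsto_iteratedDeriv_orbitalIntegral_comp_clm_uniform` supplies the one-sided limits
`Lp, Lm ∈ P′ →ᵇ E` of the `(P′ →ᵇ E)`-valued jet `ψ_k ↦ (F′ g)⁽ⁿ⁾ ψ_k` (`P′` = the closed cube of the other angles × the compact parameters), and this file turns them into the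
jointly continuous extension the next ★ (CURRY-∞) `contDiff_curry_of_forall_apply_eq` call consumes.
HONEST LABEL: HC_CM is proved only modulo the 7 printed citations (2 remaining: hLiu418 = `stmt-HodgeConjecture-24832`, h413 = `stmt-HodgeConjecture-24833`) until rung 0 closes;
pure topology, count-neutral, pays nothing by itself.

## References
* [Dieudonne1960] J. Dieudonné, *Foundations of Modern Analysis* (1960), (3.15.4) (limits and continuity on a subspace), (7.2.1) (uniform limits of continuous maps).
-/

set_option autoImplicit false

noncomputable section

open Set Filter Topology BoundedContinuousFunction

namespace Literature.Topology

variable {P : Type*} [TopologicalSpace P] {E : Type*} [PseudoMetricSpace E]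

/-! ## §1 Left end `a⁺` -/

/-- **Gluing the right-hand limit at `a`**: if `u → L` along `𝓝[>] a` then `t ↦ if a < t then u t else L` is continuous at `a` within `[a, ∞)`. [cite: Dieudonne1960, (3.15.4)] -/
theorem continuousWithinAt_Ici_glue_of_tendsto {u : ℝ → (P →ᵇ E)} {L : P →ᵇ E} {a : ℝ} (hL : Tendsto u (𝓝[>] a) (𝓝 L)) :
    ContinuousWithinAt (fun t => if a < t then u t else L) (Ici a) a := by
  rw [← continuousWithinAt_Ioi_iff_Ici, ContinuousWithinAt, if_neg (lt_irrefl a)]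
  exact hL.congr' (eventually_nhdsWithin_of_forall fun t ht => (if_pos (mem_Ioi.1 ht)).symm)

/-- **The glued map is continuous on `[a, b)`** when `u` is continuous on `(a, b)` and `u → L` along `𝓝[>] a`. [cite: Dieudonne1960, (3.15.4)] -/
theorem continuousOn_Ico_glue_of_tendsto {u : ℝ → (P →ᵇ E)} {L : P →ᵇ E} {a b : ℝ} (hu : ContinuousOn u (Ioo a b)) (hL : Tendsto u (𝓝[>] a) (𝓝 L)) :
    ContinuousOn (fun t => if a < t then u t else L) (Ico a b) := by
  intro t ht
  rcases eq_or_lt_of_le ht.1 with h | hat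
  · subst h
    exact (continuousWithinAt_Ici_glue_of_tendsto hL).mono Ico_subset_Ici_self
  · have hcont : ContinuousAt u t := hu.continuousAt (Ioo_mem_nhds hat ht.2)
    have heq : u =ᶠ[𝓝 t] fun t => if a < t then u t else L := eventually_of_mem (Ioi_mem_nhds hat) fun s hs => (if_pos (mem_Ioi.1 hs)).symm
    exact (hcont.congr heq).continuousWithinAt

/-- **JOINT CONTINUITY OF THE GLUED EVALUATION on `[a, b) × P`**: `(t, p) ↦ (if a < t then u t else L) p` is continuous on `Ico a b ×ˢ univ` — the sup-norm convergence
`u → L` is uniform convergence in `p`, and evaluation `(P →ᵇ E) × P → E` is jointly continuous. [cite: Dieudonne1960, (3.15.4), (7.2.1)] -/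
theorem continuousOn_eval_Ico_glue_of_tendsto {u : ℝ → (P →ᵇ E)} {L : P →ᵇ E} {a b : ℝ} (hu : ContinuousOn u (Ioo a b)) (hL : Tendsto u (𝓝[>] a) (𝓝 L)) :
    ContinuousOn (fun x : ℝ × P => (if a < x.1 then u x.1 else L) x.2) (Ico a b ×ˢ univ) := by
  have h1 : ContinuousOn (fun x : ℝ × P => ((if a < x.1 then u x.1 else L), x.2)) (Ico a b ×ˢ univ) :=
    (((continuousOn_Ico_glue_of_tendsto hu hL).comp continuous_fst.continuousOn fun x hx => hx.1).prodMk continuous_snd.continuousOn)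
  exact (ContinuousEval.continuous_eval (F := P →ᵇ E)).comp_continuousOn h1

/-- **Compact-parameter form**: for `b′ < b` the glued evaluation is continuous on the TYPE `↥(Icc a b′) × P` (the shape ★ (CURRY-∞) `contDiff_curry_of_forall_apply_eq` reads, with
the compact parameter space `↥(Icc a b′) × P`). [cite: Dieudonne1960, (3.15.4), (7.2.1)] -/
theorem continuous_eval_Icc_glue_of_tendsto {u : ℝ → (P →ᵇ E)} {L : P →ᵇ E} {a b b' : ℝ} (hb : b' < b) (hu : ContinuousOn u (Ioo a b)) (hL : Tendsto u (𝓝[>] a) (𝓝 L)) :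
    Continuous fun x : ↥(Icc a b') × P => (if a < (x.1 : ℝ) then u x.1 else L) x.2 := by
  have h := continuousOn_eval_Ico_glue_of_tendsto hu hL
  exact h.comp_continuous ((continuous_subtype_val.comp continuous_fst).prodMk continuous_snd) fun x => ⟨⟨x.1.2.1, lt_of_le_of_lt x.1.2.2 hb⟩, mem_univ _⟩

/-! ## §2 Right end `b⁻` -/

/-- **Gluing the left-hand limit at `b`**: if `u → L` along `𝓝[<] b` then `t ↦ if t < b then u t else L` is continuous at `b` within `(−∞, b]`. [cite: Dieudonne1960, (3.15.4)] -/
theorem continuousWithinAt_Iic_glue_of_tendsto {u : ℝ → (P →ᵇ E)} {L : P →ᵇ E} {b : ℝ} (hL : Tendsto u (𝓝[<] b) (𝓝 L)) :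
    ContinuousWithinAt (fun t => if t < b then u t else L) (Iic b) b := by
  rw [← continuousWithinAt_Iio_iff_Iic, ContinuousWithinAt, if_neg (lt_irrefl b)]
  exact hL.congr' (eventually_nhdsWithin_of_forall fun t ht => (if_pos (mem_Iio.1 ht)).symm)

/-- **The glued map is continuous on `(a, b]`** when `u` is continuous on `(a, b)` and `u → L` along `𝓝[<] b`. [cite: Dieudonne1960, (3.15.4)] -/
theorem continuousOn_Ioc_glue_of_tendsto {u : ℝ → (P →ᵇ E)} {L : P →ᵇ E} {a b : ℝ} (hu : ContinuousOn u (Ioo a b)) (hL : Tendsto u (𝓝[<] b) (𝓝 L)) :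
    ContinuousOn (fun t => if t < b then u t else L) (Ioc a b) := by
  intro t ht
  rcases eq_or_lt_of_le ht.2 with h | htb
  · subst h
    exact (continuousWithinAt_Iic_glue_of_tendsto hL).mono Ioc_subset_Iic_self
  · have hcont : ContinuousAt u t := hu.continuousAt (Ioo_mem_nhds ht.1 htb)
    have heq : u =ᶠ[𝓝 t] fun t => if t < b then u t else L := eventually_of_mem (Iio_mem_nhds htb) fun s hs => (if_pos (mem_Iio.1 hs)).symm
    exact (hcont.congr heq).continuousWithinAt

/-- **JOINT CONTINUITY OF THE GLUED EVALUATION on `(a, b] × P`.** [cite: Dieudonne1960, (3.15.4), (7.2.1)] -/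
theorem continuousOn_eval_Ioc_glue_of_tendsto {u : ℝ → (P →ᵇ E)} {L : P →ᵇ E} {a b : ℝ} (hu : ContinuousOn u (Ioo a b)) (hL : Tendsto u (𝓝[<] b) (𝓝 L)) :
    ContinuousOn (fun x : ℝ × P => (if x.1 < b then u x.1 else L) x.2) (Ioc a b ×ˢ univ) := by
  have h1 : ContinuousOn (fun x : ℝ × P => ((if x.1 < b then u x.1 else L), x.2)) (Ioc a b ×ˢ univ) :=
    (((continuousOn_Ioc_glue_of_tendsto hu hL).comp continuous_fst.continuousOn fun x hx => hx.1).prodMk continuous_snd.continuousOn)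
  exact (ContinuousEval.continuous_eval (F := P →ᵇ E)).comp_continuousOn h1

/-- **Compact-parameter form at the right end**: for `a < a′` the glued evaluation is continuous on `↥(Icc a′ b) × P`. [cite: Dieudonne1960, (3.15.4), (7.2.1)] -/
theorem continuous_eval_Icc_glue_of_tendsto_right {u : ℝ → (P →ᵇ E)} {L : P →ᵇ E} {a a' b : ℝ} (ha : a < a') (hu : ContinuousOn u (Ioo a b)) (hL : Tendsto u (𝓝[<] b) (𝓝 L)) :
    Continuous fun x : ↥(Icc a' b) × P => (if (x.1 : ℝ) < b then u x.1 else L) x.2 := by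
  have h := continuousOn_eval_Ioc_glue_of_tendsto hu hL
  exact h.comp_continuous ((continuous_subtype_val.comp continuous_fst).prodMk continuous_snd) fun x => ⟨⟨lt_of_lt_of_le ha x.1.2.1, x.1.2.2⟩, mem_univ _⟩

/-! ## §3 Uniformity read back pointwise -/

omit [TopologicalSpace P] in
/-- **Sup-norm convergence is uniform convergence**: `u → L` in `P →ᵇ E` along a filter gives, for every `ε > 0`, eventually `dist (u t p) (L p) ≤ ε` for ALL `p` at once.
[cite: Dieudonne1960, (7.2.1)] -/
theorem eventually_forall_dist_le_of_tendsto [TopologicalSpace P] {u : ℝ → (P →ᵇ E)} {L : P →ᵇ E} {l : Filter ℝ} (hL : Tendsto u l (𝓝 L)) {ε : ℝ} (hε : 0 < ε) :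
    ∀ᶠ t in l, ∀ p : P, dist (u t p) (L p) ≤ ε := by
  filter_upwards [hL (Metric.closedBall_mem_nhds L hε)] with t ht p
  exact (dist_coe_le_dist p).trans (Metric.mem_closedBall.1 ht)

end Literature.Topology

end
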